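import Summits.BirchSwinnertonDyer.BirchSwinnertonDyer.Theorems.ByReductionTypeAtTwoRankOneAtTwoOffBigImageOddLocalCellGlue
import Summits.BirchSwinnertonDyer.BirchSwinnertonDyer.Theorems.ByReductionTypeAtTwoRankOneAtTwoOffBigImageOddLocalDeepDefs
import HarnessLib

/-!
# Route `ByReductionTypeAtTwo`, crux `RankOneAtTwoOffBigImageOddLocal` (stmt-BirchSwinnertonDyer-23716), line
# `refined_kolyvagin_tamagawa_shift_at_two`: the S₃-locus GLUE in the DEEP witness currency of the re-cut (RC-343, R1 + R2) — PROVED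

Lead prover `prover-cruxlead-stmt-BirchSwinnertonDyer-23716-g6` (2026-08-28), `--supports stmt-BirchSwinnertonDyer-23716` (helper; closes nothing).
THEOREMS ONLY (no definition, no named fact, no `sorry`), over `…OffBigImageOddLocalCellGlue.lean` (p646363) and the third statement module
`…OffBigImageOddLocalDeepDefs.lean` (p674589).  The pen's ruling RC-343 re-cuts the line's K-side witness currency after the lead's first-rung
analysis (`Cruxes/…/FirstRungAtTwo.md`, kernel `…FirstRungAtTwo.lean` p673379): the stringent-primitivity witness is taken at level
`≥ max(σ + 1, M₀ + 1)` (R1) on REGULAR primes over the full-image cell (R2).  This file re-plumbs the glue accordingly: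

* §1 comparisons — the deep currency asks LESS of the structure stubs (`structureDeepWithOn_of_withOn`, `structureDeepWithOnPos_of_withOnPos`:
  registered ⟹ deep) and MORE of the supply stub (`stringentModTwo_of_deepWith`: S4′(∞, Φ) ⟹ the registered S4′); monotonicity / antitonicity in
  the filter and cell slots; the re-cut filter `RegularOnFullImageAtTwo` is `RegularAtTwo` on δ and vacuous off it.
* §2 `bsdp_two_S3locusDeepWithOn Φ Ω` — the per-cell glue: PRINT ∧ K1 ∧ K2(∞, Φ, Ω) ∧ K3(deep, Φ, Ω) ∧ rank-`0` `BSD₂` ⟹ `BSD₂` on `Ω` ∩ (S₃-locus,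
  non-CM, analytic rank `1`).  Body = `bsdp_two_S3locusWithOn` (p646363) with the witness drawn from the infinite-supply stub at level `L := M₀ + 1`
  AFTER `M₀ = ord₂ y_K` is fixed (`σ + 1 ≤ M₀ + 1` by Σ-accumulation at `n = 1`).
* §3 `bsdp_two_S3locusDeep_of_atlas`, `bsdp_two_S3locusDeep_imageCells Φδ Φγ` — atlases; the image-cell instance takes ONE cell-free supply stub
  K2(∞, Φδ) with `Φδ ≤ Φγ` and the two deep structure statements (δ with `Φδ`, γ₂ with `Φγ`).

The re-cut skeleton (g13) registers `stub_stringentPrimitivityModTwo : StringentPrimitivityModTwoDeepWith RegularOnFullImageAtTwo`,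
`stub_sigmaShiftPosDisc : ShiftedKolyvaginStructureModTwoDeepWithOnPos RegularOnFullImageAtTwo OnDeltaPlusCell`, `stub_gamma2SmallImage :
ShiftedKolyvaginStructureModTwoDeepWithOn ⊤ OffFullImageCell` and composes through `bsdp_two_S3locusDeep_imageCells` and the sibling-names glue
(`…OffBigImageOddLocalDeepSiblingGlue.lean`).  BSD is not proved by any of this; the crux is not proved; every K-side statement stays OPEN at `p = 2`.

References: [McCallumLMS1991] §5 Lemma 5.1, Thm. 5.4; [GrossLMS1991] §2 Conj. (2.2), §§3–4; [Jetchev2008] p. 3 Hyp., (1.3); [WZhang2014] §3.7.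
-/

set_option linter.dupNamespace false -- tree convention: `Summit.BirchSwinnertonDyer.BirchSwinnertonDyer.Theorems` (summit = sub-problem)
set_option autoImplicit false

noncomputable section

open scoped Classical

namespace Summit.BirchSwinnertonDyer.BirchSwinnertonDyer.Theorems.OffBigImageOddLocalAtTwo

open WeierstrassCurve NumberField IsDedekindDomain Rat.HeightOneSpectrum Literature.NumberTheory.EllipticCurves
  Literature.NumberTheory.EllipticCurves.ModularForms
  Literature.NumberTheory.EllipticCurves.Rank1Residual
  Literature.NumberTheory.EllipticCurves.Rank1Residual.Typed
  Literature.NumberTheory.EllipticCurves.KrizLi2019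
  Summit.BirchSwinnertonDyer.Rank1Residual
  Summit.BirchSwinnertonDyer.Rank1Residual.AdditivePotMult
  Summit.BirchSwinnertonDyer.Rank1Residual.F1Sign2
  Summit.BirchSwinnertonDyer.Rank1Residual.F1Sign2.TranspositionDoor
  Summit.BirchSwinnertonDyer.BirchSwinnertonDyer.Theorems.RankOneAtTwoOneDoor
  Summit.BirchSwinnertonDyer.BirchSwinnertonDyer.Theorems.CMExactDescent

/-! ## §1 Comparisons: the deep currency is WEAKER on the structure side and STRONGER on the supply side -/

/-- **S4′(∞, Φ) ⟹ S4′(Φ)** (take `L := σ + 1`): the infinite-supply form implies the registered cell-free form.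
[cite: WZhang2014, §3.7] -/
theorem stringentWith_of_deepWith (Φ : WeierstrassCurve ℚ → ℕ → Prop) (h : StringentPrimitivityModTwoDeepWith Φ) :
    StringentPrimitivityModTwoWith Φ :=
  fun W _ _ _ hCM hρ hr K _ _ hK hodd h3 hH hsq1 hsq2 Dt β ι d₁ hy =>
    h W hCM hρ hr K hK hodd h3 hH hsq1 hsq2 Dt β ι d₁ hy (sigmaShift W Dt + 1)

/-- **S4′(∞, Φ) ⟹ the registered S4′** (`StringentPrimitivityModTwoAtTwo` = `Φ = ⊤`, `L = σ + 1`): the re-cut's supply stub is STRONGER than the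
one it replaces (so every consumer of the old stub is still fed). [cite: WZhang2014, §3.7] -/
theorem stringentModTwo_of_deepWith (Φ : WeierstrassCurve ℚ → ℕ → Prop) (h : StringentPrimitivityModTwoDeepWith Φ) :
    StringentPrimitivityModTwoAtTwo := by
  intro W _ _ _ hCM hρ hr K _ _ hK hodd h3 hH hsq1 hsq2 Dt β ι d₁ hy
  obtain ⟨n, d, hn, hKoly, hlev, hPn⟩ := h W hCM hρ hr K hK hodd h3 hH hsq1 hsq2 Dt β ι d₁ hy (sigmaShift W Dt + 1)
  exact ⟨n, d, hn, fun ℓ hℓ => (hKoly ℓ hℓ).1, hlev, hPn⟩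

/-- Cell-free ⟹ on every cell (drop the binder). [cite: WZhang2014, §3.7] -/
theorem stringentDeepWithOn_of_deepWith (Φ : WeierstrassCurve ℚ → ℕ → Prop) (Ω : WeierstrassCurve ℚ → Prop)
    (h : StringentPrimitivityModTwoDeepWith Φ) : StringentPrimitivityModTwoDeepWithOn Φ Ω :=
  fun W _ _ _ hCM hρ _ hr K _ _ hK hodd h3 hH hsq1 hsq2 Dt β ι d₁ hy L =>
    h W hCM hρ hr K hK hodd h3 hH hsq1 hsq2 Dt β ι d₁ hy L

/-- **Monotonicity of S4″(∞, Φ, Ω)**: a finer filter / smaller cell is implied by a coarser filter... precisely: witnesses on `Φ`-primes over `Ω`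
give witnesses on `Ψ`-primes over `Ω' ⊆ Ω` whenever `Φ ≤ Ψ`. [cite: WZhang2014, §3.7] -/
theorem stringentDeepWithOn_mono {Φ Ψ : WeierstrassCurve ℚ → ℕ → Prop} {Ω Ω' : WeierstrassCurve ℚ → Prop}
    (hΦ : ∀ W ℓ, Φ W ℓ → Ψ W ℓ) (hΩ : ∀ W, Ω' W → Ω W) (h : StringentPrimitivityModTwoDeepWithOn Φ Ω) :
    StringentPrimitivityModTwoDeepWithOn Ψ Ω' := by
  intro W _ _ _ hCM hρ hW hr K _ _ hK hodd h3 hH hsq1 hsq2 Dt β ι d₁ hy L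
  obtain ⟨n, d, hn, hKoly, hlev, hPn⟩ := h W hCM hρ (hΩ W hW) hr K hK hodd h3 hH hsq1 hsq2 Dt β ι d₁ hy L
  exact ⟨n, d, hn, fun ℓ hℓ => ⟨(hKoly ℓ hℓ).1, hΦ W ℓ (hKoly ℓ hℓ).2⟩, hlev, hPn⟩

/-- **The registered S5″(Φ, Ω) implies the deep one** (the extra witness line is simply not used): the re-cut asks for LESS.
[cite: McCallumLMS1991, §5 Thm. 5.4] -/
theorem structureDeepWithOn_of_withOn (Φ : WeierstrassCurve ℚ → ℕ → Prop) (Ω : WeierstrassCurve ℚ → Prop)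
    (h : ShiftedKolyvaginStructureModTwoWithOn Φ Ω) : ShiftedKolyvaginStructureModTwoDeepWithOn Φ Ω :=
  fun W _ _ _ hCM hρ hW K _ _ hK hodd h3 hH hsq1 hsq2 Dt β ι d₁ hy M₀ hdiv hndiv hacc n d hn hKoly hlev _ hPn =>
    h W hCM hρ hW K hK hodd h3 hH hsq1 hsq2 Dt β ι d₁ hy M₀ hdiv hndiv hacc n d hn hKoly hlev hPn

/-- **The registered S5⁺(Φ, Ω) implies the deep one.** [cite: McCallumLMS1991, §5 Thm. 5.4] -/
theorem structureDeepWithOnPos_of_withOnPos (Φ : WeierstrassCurve ℚ → ℕ → Prop) (Ω : WeierstrassCurve ℚ → Prop)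
    (h : ShiftedKolyvaginStructureModTwoWithOnPos Φ Ω) : ShiftedKolyvaginStructureModTwoDeepWithOnPos Φ Ω :=
  fun W _ _ _ hCM hρ hW K _ _ hK hodd h3 hH hsq1 hsq2 Dt β ι d₁ hy hσ M₀ hdiv hndiv hacc n d hn hKoly hlev _ hPn =>
    h W hCM hρ hW K hK hodd h3 hH hsq1 hsq2 Dt β ι d₁ hy hσ M₀ hdiv hndiv hacc n d hn hKoly hlev hPn

/-- Deep S5″ (all shifts) gives deep S5⁺ (positive shifts): drop the binder. [cite: McCallumLMS1991, §5 Thm. 5.4] -/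
theorem structureDeepWithOnPos_of_deepWithOn (Φ : WeierstrassCurve ℚ → ℕ → Prop) (Ω : WeierstrassCurve ℚ → Prop)
    (h : ShiftedKolyvaginStructureModTwoDeepWithOn Φ Ω) : ShiftedKolyvaginStructureModTwoDeepWithOnPos Φ Ω :=
  fun W _ _ _ hCM hρ hW K _ _ hK hodd h3 hH hsq1 hsq2 Dt β ι d₁ hy _ M₀ hdiv hndiv hacc n d hn hKoly hlev hlev' hPn =>
    h W hCM hρ hW K hK hodd h3 hH hsq1 hsq2 Dt β ι d₁ hy M₀ hdiv hndiv hacc n d hn hKoly hlev hlev' hPn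

/-- **Antitonicity of deep S5″** (finer filter / smaller cell ⇒ weaker). [cite: McCallumLMS1991, §5 Thm. 5.4] -/
theorem structureDeepWithOn_anti {Φ Ψ : WeierstrassCurve ℚ → ℕ → Prop} {Ω Ω' : WeierstrassCurve ℚ → Prop}
    (hΦ : ∀ W ℓ, Φ W ℓ → Ψ W ℓ) (hΩ : ∀ W, Ω' W → Ω W) (h : ShiftedKolyvaginStructureModTwoDeepWithOn Ψ Ω) :
    ShiftedKolyvaginStructureModTwoDeepWithOn Φ Ω' :=
  fun W _ _ _ hCM hρ hW K _ _ hK hodd h3 hH hsq1 hsq2 Dt β ι d₁ hy M₀ hdiv hndiv hacc n d hn hKoly hlev hlev' hPn =>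
    h W hCM hρ (hΩ W hW) K hK hodd h3 hH hsq1 hsq2 Dt β ι d₁ hy M₀ hdiv hndiv hacc n d hn
      (fun ℓ hℓ => ⟨(hKoly ℓ hℓ).1, hΦ W ℓ (hKoly ℓ hℓ).2⟩) hlev hlev' hPn

/-- **Antitonicity of deep S5⁺.** [cite: McCallumLMS1991, §5 Thm. 5.4] -/
theorem structureDeepWithOnPos_anti {Φ Ψ : WeierstrassCurve ℚ → ℕ → Prop} {Ω Ω' : WeierstrassCurve ℚ → Prop}
    (hΦ : ∀ W ℓ, Φ W ℓ → Ψ W ℓ) (hΩ : ∀ W, Ω' W → Ω W) (h : ShiftedKolyvaginStructureModTwoDeepWithOnPos Ψ Ω) :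
    ShiftedKolyvaginStructureModTwoDeepWithOnPos Φ Ω' :=
  fun W _ _ _ hCM hρ hW K _ _ hK hodd h3 hH hsq1 hsq2 Dt β ι d₁ hy hσ M₀ hdiv hndiv hacc n d hn hKoly hlev hlev' hPn =>
    h W hCM hρ (hΩ W hW) K hK hodd h3 hH hsq1 hsq2 Dt β ι d₁ hy hσ M₀ hdiv hndiv hacc n d hn
      (fun ℓ hℓ => ⟨(hKoly ℓ hℓ).1, hΦ W ℓ (hKoly ℓ hℓ).2⟩) hlev hlev' hPn

/-- Off the full-image cell the re-cut's filter is vacuous (`RegularOnFullImageAtTwo W ℓ` holds for every `ℓ`). [folklore] -/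
theorem regularOnFullImage_of_offFullImageCell (W : WeierstrassCurve ℚ) (h : OffFullImageCell W) (ℓ : ℕ) :
    RegularOnFullImageAtTwo W ℓ :=
  fun hfull => (h hfull).elim

/-- On the full-image cell the re-cut's filter IS `RegularAtTwo`. [folklore] -/
theorem regularAtTwo_of_regularOnFullImage (W : WeierstrassCurve ℚ) (hfull : OnFullImageCell W) (ℓ : ℕ)
    (h : RegularOnFullImageAtTwo W ℓ) : RegularAtTwo W ℓ :=
  h hfull

/-! ## §2 The S₃-locus glue PER CELL in the deep currency: the witness is drawn from S4′(∞) at level `M₀ + 1` -/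

/-- **S₃-locus glue PER CELL, deep currency (RC-343 R1)**: PRINT, K1, K2(∞, Φ, Ω), K3(deep, Φ, Ω), rank-`0` `BSD₂` of non-CM curves ⟹ `BSD₂(W)` for `W`
non-CM with `ρ̄_{W,2}` onto, `W ∈ Ω`, analytic rank `1`.  The body is `bsdp_two_S3locusWithOn`'s with ONE change: after `M₀ = ord₂(y_K)` is fixed, the
stringent-primitivity witness is taken from the infinite-supply stub at level `L := M₀ + 1` (and `σ + 1 ≤ M₀ + 1 ≤ M(n)` because Σ-accumulation at
`n = 1` gives `σ ≤ M₀`), so that the deep structure statement applies. [cite: GrossLMS1991, §2 Conj. (2.2), §§3–4] [cite: McCallumLMS1991, §5]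
[cite: Jetchev2008, p. 3 Hyp., (1.3)] -/
theorem bsdp_two_S3locusDeepWithOn (Φ : WeierstrassCurve ℚ → ℕ → Prop) (Ω : WeierstrassCurve ℚ → Prop)
    (hpub : S_pub) (hHL : S_pubHL) (hMilneC : Milne1972.bsdQuotient_baseChange_quadratic_anyModel)
    (hK1 : SigmaAccumulationModTwoAtTwo) (hK2 : StringentPrimitivityModTwoDeepWithOn Φ Ω)
    (hK3 : ShiftedKolyvaginStructureModTwoDeepWithOn Φ Ω)
    (hZ : S_rankZeroTwin)
    (W : WeierstrassCurve ℚ) [W.IsElliptic] [W.IsGloballyMinimal] (hCM : ¬ W.HasCM)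
    (hρ2 : W.HasSurjectiveModNGaloisRep 2) (hΩ : Ω W) (hr : W.analyticRank = 1) : BSDp W 2 := by
  haveI : Fact (Nat.Prime 2) := ⟨Nat.prime_two⟩
  haveI hN : NeZero (W.conductorNorm ℤ) := ⟨(W.conductorNorm_pos_holds).ne'⟩
  have hnf : exists_isNewformOf := hHL.1
  have hmod : hasEntireLFunction_rat := hpub.2.2
  have hGZK : rank_eq_analyticRank_of_analyticRank_le_one := hpub.2.1
  -- the Kolyvagin-admissible door
  obtain ⟨K, _iF, _iN, hK, hodd, h3, hH, hsq1, hsq2, -, hLt, -⟩ :=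
    exists_kolyvaginDoorField_of_analyticRank_eq_one hnf hHL.2 W hr
  -- ANY datum, the orientation, the embedding, the conductor-`1` datum
  obtain ⟨Dt⟩ := (nonempty_modularParametrizationData_iff_exists_isNewformOf_unconditional.mpr hnf) W
  obtain ⟨β, hβ⟩ : ∃ β : ℤ, (4 * (W.conductorNorm ℤ : ℕ) : ℤ) ∣ β ^ 2 - NumberField.discr K :=
    Literature.NumberTheory.QuadraticFields.Quadratic.exists_dvd_sq_sub_discr_of_ncard_primesOver hK.1 (NeZero.ne _) hH
  obtain ⟨ι⟩ : Nonempty (K →+* ℂ) := inferInstance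
  obtain ⟨d₁⟩ := exists_kolyvaginHeegnerData_one
    (phi_heegnerTau_mem_singularModuliField_holds (W.conductorNorm ℤ) W K) hK Dt β ι hβ
  -- `y_K` has infinite order: `L'(W/K, 1) = L'(W, 1) · L(W^{(d_K)}, 1) ≠ 0` and Gross–Zagier
  haveI hEK : (W.baseChange K).IsElliptic := isElliptic_baseChange' W K
  have hL0 : W.entireLFunction 1 = 0 := entireLFunction_one_eq_zero_of_analyticRank_eq_one hr
  obtain ⟨-, hderiv⟩ := leadingLCoeff_eq_deriv_of_analyticRank_eq_one hr
  have hLK : LDerivEK W K ≠ 0 := by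
    rw [lDerivEK_eq_deriv_mul W K hmod hL0]; exact mul_ne_zero hderiv hLt
  obtain ⟨hGZ, -, -⟩ := hpub.1 (W.conductorNorm ℤ) W K
  obtain ⟨P₀, Hd, hP₀, hP₀K⟩ := exists_heegnerPoint_map_eq_derivedPoint_one hK hH d₁
  have hP₀inf : ¬ IsOfFinAddOrder P₀ :=
    (lDerivEK_ne_zero_iff_not_isOfFinAddOrder W (W.conductorNorm ℤ) K hGZ hK hH ⟨Dt, Hd, ι, hP₀⟩).mp hLK
  have hy : ¬ IsOfFinAddOrder d₁.derivedPoint := by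
    intro hfin
    apply hP₀inf
    rw [← hP₀K] at hfin
    exact (WeierstrassCurve.Affine.Point.map_injective (W' := W) _).isOfFinAddOrder_iff.mp hfin
  -- `M₀ = ord₂(y_K)` in `E(K[1])` (a number field: finite generation)
  obtain ⟨M₀, hdiv, hndiv⟩ : ∃ M₀ : ℕ,
      (∃ Q : (W.baseChange (ringClassField K ι 1)).toAffine.Point, ((2 ^ M₀ : ℕ) : ℤ) • Q = d₁.derivedPoint) ∧
      ¬ ∃ Q : (W.baseChange (ringClassField K ι 1)).toAffine.Point, ((2 ^ (M₀ + 1) : ℕ) : ℤ) • Q = d₁.derivedPoint := by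
    haveI : NumberField (ringClassField K ι 1) := numberField_ringClassField hK ι one_ne_zero
    haveI : (W.baseChange (ringClassField K ι 1)).IsElliptic := by rw [baseChange]; infer_instance
    haveI : Module.Finite ℤ (W.baseChange (ringClassField K ι 1)).toAffine.Point := by
      convert (W.baseChange (ringClassField K ι 1)).module_finite_point_holds
    exact exists_pow_smul_eq_and_not_of_not_isOfFinAddOrder Nat.prime_two hy
  -- Σ-accumulation and `σ ≤ M₀` (accumulation at `n = 1`, `M(1) = ∞`, against the exactness of `M₀`)
  have hacc := hK1 W hCM hρ2 hr K hK hodd h3 hH hsq1 hsq2 Dt β ι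
  have hσ : sigmaShift W Dt ≤ M₀ := by
    by_contra hlt
    push Not at hlt
    exact hndiv (hacc 1 d₁ (M₀ + 1) squarefree_one (by simp) (by simp) (by omega))
  -- the DEEP witness: stringent primitivity at level `L := M₀ + 1 ≥ σ + 1`
  obtain ⟨n, d, hn, hKoly, hlev', hPn⟩ := hK2 W hCM hρ2 hΩ hr K hK hodd h3 hH hsq1 hsq2 Dt β ι d₁ hy (M₀ + 1)
  have hlev : ((sigmaShift W Dt + 1 : ℕ) : ℕ∞) ≤ Zhang2014.levelIndex W 2 n :=
    le_trans (by exact_mod_cast Nat.succ_le_succ hσ) hlev'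
  have hsha : Nat.card (AddCommGroup.primaryComponent (W.baseChange K).sha 2) = 2 ^ (2 * (M₀ - sigmaShift W Dt)) :=
    hK3 W hCM hρ2 hΩ K hK hodd h3 hH hsq1 hsq2 Dt β ι d₁ hy M₀ hdiv hndiv hacc n d hn hKoly hlev hlev' hPn
  -- the twin: a globally minimal model, non-CM, of analytic rank `0`; its `BSD₂` from the rank-`0` statement
  have hD0 : (NumberField.discr K : ℚ) ≠ 0 := by exact_mod_cast NumberField.discr_ne_zero K
  haveI hEt : (W.quadraticTwist (NumberField.discr K : ℚ)).IsElliptic := W.isElliptic_quadraticTwist hD0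
  obtain ⟨Cd, hCd⟩ := hasGlobalMinimalModel_rat_holds (W.quadraticTwist (NumberField.discr K : ℚ))
  haveI : (Cd • W.quadraticTwist (NumberField.discr K : ℚ)).IsGloballyMinimal := hCd
  have hCMd : ¬ (Cd • W.quadraticTwist (NumberField.discr K : ℚ)).HasCM :=
    Summit.BirchSwinnertonDyer.BirchSwinnertonDyer.Theorems.RamifiedPairUpperBound.not_hasCM_of_smul_quadraticTwist_eq hD0 rfl hCM
  have hrt : (W.quadraticTwist (NumberField.discr K : ℚ)).analyticRank = 0 :=
    ((W.quadraticTwist _).analyticRank_eq_zero_iff_holds (hmod _)).mpr hLt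
  have hrd : (Cd • W.quadraticTwist (NumberField.discr K : ℚ)).analyticRank = 0 := by
    rw [analyticRank_smul, hrt]
  have hBd : BSDp (Cd • W.quadraticTwist (NumberField.discr K : ℚ)) 2 := hZ _ hCMd hrd
  exact bsdp_two_of_card_sha_baseChange_eq_shifted_rankOne W K Dt β ι d₁ (Cd • W.quadraticTwist (NumberField.discr K : ℚ))
    hGZ hGZK hmod hMilneC hρ2 hr hK hodd h3 hH hy hdiv hndiv hσ hsha ⟨Cd, rfl⟩ hBd

/-! ## §3 Atlases in the deep currency -/

/-- **Cover lemma (any atlas), deep currency**: cells `Ω i` with filters `Φ i`, the deep pair (K2(∞), K3(deep)) on each, and a cover of the S₃-locus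
by the cells ⟹ `BSD₂` on the whole S₃-locus (non-CM, analytic rank `1`). [cite: McCallumLMS1991, §5] -/
theorem bsdp_two_S3locusDeep_of_atlas {ι : Type*} (Φ : ι → WeierstrassCurve ℚ → ℕ → Prop) (Ω : ι → WeierstrassCurve ℚ → Prop)
    (hpub : S_pub) (hHL : S_pubHL) (hMilneC : Milne1972.bsdQuotient_baseChange_quadratic_anyModel)
    (hK1 : SigmaAccumulationModTwoAtTwo)
    (hK2 : ∀ i, StringentPrimitivityModTwoDeepWithOn (Φ i) (Ω i)) (hK3 : ∀ i, ShiftedKolyvaginStructureModTwoDeepWithOn (Φ i) (Ω i))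
    (hZ : S_rankZeroTwin)
    (hcover : ∀ (W : WeierstrassCurve ℚ) [W.IsElliptic] [W.IsGloballyMinimal], ¬ W.HasCM →
      W.HasSurjectiveModNGaloisRep 2 → W.analyticRank = 1 → ∃ i, Ω i W)
    (W : WeierstrassCurve ℚ) [W.IsElliptic] [W.IsGloballyMinimal] (hCM : ¬ W.HasCM)
    (hρ2 : W.HasSurjectiveModNGaloisRep 2) (hr : W.analyticRank = 1) : BSDp W 2 := by
  obtain ⟨i, hi⟩ := hcover W hCM hρ2 hr
  exact bsdp_two_S3locusDeepWithOn (Φ i) (Ω i) hpub hHL hMilneC hK1 (hK2 i) (hK3 i) hZ W hCM hρ2 hi hr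

/-- **S₃-locus glue through the IMAGE-CELL atlas, deep currency**: K1, ONE cell-free supply stub K2(∞, Φδ) whose filter is at most `Φγ` (fed to the
γ₂ cell by monotonicity), K3(deep, Φδ) on the full-image cell δ and K3(deep, Φγ) on its complement γ₂, PRINT and rank-`0` `BSD₂` ⟹ `BSD₂(W)` for
every non-CM `W` with `ρ̄_{W,2}` onto of analytic rank `1`.  The re-cut skeleton's instance: `Φδ = RegularOnFullImageAtTwo`, `Φγ = ⊤`.
[cite: McCallumLMS1991, §5] [cite: RouseZureickbrown2015, §1] -/
theorem bsdp_two_S3locusDeep_imageCells (Φδ Φγ : WeierstrassCurve ℚ → ℕ → Prop) (hΦ : ∀ W ℓ, Φδ W ℓ → Φγ W ℓ)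
    (hpub : S_pub) (hHL : S_pubHL) (hMilneC : Milne1972.bsdQuotient_baseChange_quadratic_anyModel)
    (hK1 : SigmaAccumulationModTwoAtTwo)
    (hK2 : StringentPrimitivityModTwoDeepWith Φδ)
    (hK3δ : ShiftedKolyvaginStructureModTwoDeepWithOn Φδ OnFullImageCell)
    (hK3γ : ShiftedKolyvaginStructureModTwoDeepWithOn Φγ OffFullImageCell)
    (hZ : S_rankZeroTwin)
    (W : WeierstrassCurve ℚ) [W.IsElliptic] [W.IsGloballyMinimal] (hCM : ¬ W.HasCM)
    (hρ2 : W.HasSurjectiveModNGaloisRep 2) (hr : W.analyticRank = 1) : BSDp W 2 := by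
  have hK2δ : StringentPrimitivityModTwoDeepWithOn Φδ OnFullImageCell := stringentDeepWithOn_of_deepWith Φδ _ hK2
  have hK2γ : StringentPrimitivityModTwoDeepWithOn Φγ OffFullImageCell :=
    stringentDeepWithOn_mono hΦ (fun _ h => h) (stringentDeepWithOn_of_deepWith Φδ OffFullImageCell hK2)
  exact bsdp_two_S3locusDeep_of_atlas (fun b : Bool => if b then Φδ else Φγ) (fun b => if b then OnFullImageCell else OffFullImageCell)
    hpub hHL hMilneC hK1 (fun b => by cases b <;> assumption) (fun b => by cases b <;> assumption) hZ
    (fun V _ _ _ _ _ => (Classical.em (OnFullImageCell V)).elim (fun h => ⟨true, h⟩) (fun h => ⟨false, h⟩)) W hCM hρ2 hr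

end Summit.BirchSwinnertonDyer.BirchSwinnertonDyer.Theorems.OffBigImageOddLocalAtTwo

end
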